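import Summits.CriticalPhenomena.SAWScalingLimit.Theorems.SAWReversalUpgradeAttachmentExistsSqueeze
import Summits.CriticalPhenomena.SAWScalingLimit.Theorems.SAWReversalUpgradeAttachmentExistsInverse
import Summits.CriticalPhenomena.SAWScalingLimit.Theorems.SAWReversalUpgradeAttachmentExistsTrim

/-!
# The squeezed trimmed polyline `Z = Φ ∘ A ∘ ψ ∘ R` and its trace `M = Z([i, j])`
# (route `SAWReversalUpgrade`, helper for item `AttachmentExists`, stmt-CriticalPhenomena-18009)

Continuation of `…AttachmentExistsTrim`: with `Φ` (boundary extension, abstract as in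
`…AttachmentExistsInverse`), `ψ = Φ⁻¹` on `closure D ∖ {b}`, the angular squeeze `A = A_e`
(`…AttachmentExistsSqueeze`) and the extended polyline `R`, the route statement pushes the
polyline into `D` by `Z u = if R u = b then b else Φ (A (ψ (R u)))`. We prove (`sqd_*`):
`Z u = a ↔ R u = a`, `Z u = b ↔ R u = b`, `Z u ∈ D ∪ {a, b}`; `Z s = Z t → R s = R t`
(so `Z` inherits injectivity up to the tail and the constant tail); `Z` is continuous on
`[i, j]` (at a visit of `b` through `ψ → ∞`, `A → ∞`, `Φ → b`); `Z` is injective on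
`[i, min j τ]`, and the trace `M = Z([i, j]) = Z([i, min j τ])` is compact, contains `a` iff
`R i = a`, and misses `b` unless `R j = b`.

Folklore bookkeeping.
-/

noncomputable section

namespace Summit.CriticalPhenomena.SAWScalingLimit.Theorems

open Set Function Filter Topology
open scoped unitInterval

variable {D : Set ℂ} {a b : ℂ} {Φ A ψ : ℂ → ℂ} {e : ℝ} {P : C(I, ℂ)} {R Z : ℝ → ℂ} {τ i j : ℝ}

/-! ### Values of `Z` -/

/-- Off the visits of `b`, `Z u = Φ (A (ψ (R u)))`. [folklore] -/
theorem sqd_Z_of_ne (hZ : ∀ u, Z u = @ite ℂ (R u = b) (Classical.propDecidable _) b (Φ (A (ψ (R u)))))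
    {u : ℝ} (h : R u ≠ b) : Z u = Φ (A (ψ (R u))) := by
  rw [hZ, if_neg h]

/-- At a visit of `b`, `Z u = b`. [folklore] -/
theorem sqd_Z_of_eq (hZ : ∀ u, Z u = @ite ℂ (R u = b) (Classical.propDecidable _) b (Φ (A (ψ (R u)))))
    {u : ℝ} (h : R u = b) : Z u = b := by
  rw [hZ, if_pos h]

/-- `ψ (R u) ∈ ℍ̄` and `Φ (ψ (R u)) = R u` off the visits of `b`. [folklore] -/
theorem sqd_psi_R (hψ : ψ = invFunOn Φ {z : ℂ | 0 ≤ z.im})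
    (hsurj : closure D \ {b} ⊆ Φ '' {z : ℂ | 0 ≤ z.im}) (hRcl : ∀ u, R u ∈ closure D) {u : ℝ}
    (h : R u ≠ b) : 0 ≤ (ψ (R u)).im ∧ Φ (ψ (R u)) = R u := by
  subst hψ
  exact inv_spec hsurj ⟨hRcl u, h⟩

/-- **`Z u = b ↔ R u = b`.** [folklore] -/
theorem sqd_Z_eq_b_iff (hZ : ∀ u, Z u = @ite ℂ (R u = b) (Classical.propDecidable _) b (Φ (A (ψ (R u)))))
    (hψ : ψ = invFunOn Φ {z : ℂ | 0 ≤ z.im})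
    (hsurj : closure D \ {b} ⊆ Φ '' {z : ℂ | 0 ≤ z.im}) (hRcl : ∀ u, R u ∈ closure D)
    (he0 : 0 < e) (he1 : e ≤ 1 / 2)
    (hA : ∀ z, A z = (‖z‖ : ℂ) * Complex.exp (Complex.I * ((e : ℂ) +
      (1 - 2 * (e : ℂ) / (Real.pi : ℂ)) * (Complex.arg z : ℂ))))
    (hΦb : ∀ z : ℂ, 0 ≤ z.im → Φ z ≠ b) (u : ℝ) : Z u = b ↔ R u = b := by
  refine ⟨fun h => ?_, sqd_Z_of_eq hZ⟩
  by_contra hne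
  rw [sqd_Z_of_ne hZ hne] at h
  exact hΦb _ (sqz_im_nonneg he0 he1 hA (sqd_psi_R hψ hsurj hRcl hne).1) h

/-- **`Z u = a ↔ R u = a`.** [folklore] -/
theorem sqd_Z_eq_a_iff (hZ : ∀ u, Z u = @ite ℂ (R u = b) (Classical.propDecidable _) b (Φ (A (ψ (R u)))))
    (hψ : ψ = invFunOn Φ {z : ℂ | 0 ≤ z.im}) (hΦi : InjOn Φ {z : ℂ | 0 ≤ z.im})
    (hsurj : closure D \ {b} ⊆ Φ '' {z : ℂ | 0 ≤ z.im}) (hΦ0 : Φ 0 = a)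
    (hRcl : ∀ u, R u ∈ closure D) (he0 : 0 < e) (he1 : e ≤ 1 / 2)
    (hA : ∀ z, A z = (‖z‖ : ℂ) * Complex.exp (Complex.I * ((e : ℂ) +
      (1 - 2 * (e : ℂ) / (Real.pi : ℂ)) * (Complex.arg z : ℂ)))) (u : ℝ) :
    Z u = a ↔ R u = a := by
  by_cases h : R u = b
  · rw [sqd_Z_of_eq hZ h, h]
  · rw [sqd_Z_of_ne hZ h]
    obtain ⟨him, hΦψ⟩ := sqd_psi_R hψ hsurj hRcl h
    have hmem : R u ∈ closure D \ {b} := ⟨hRcl u, h⟩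
    subst hψ
    constructor
    · intro hua
      rw [← hΦ0] at hua
      have h1 : A (invFunOn Φ {z : ℂ | 0 ≤ z.im} (R u)) = 0 :=
        hΦi (sqz_im_nonneg he0 he1 hA him) (show (0 : ℂ) ∈ {z : ℂ | 0 ≤ z.im} by simp) hua
      rw [sqz_eq_zero_iff hA] at h1
      exact (inv_eq_zero_iff hΦi hsurj hΦ0 hmem).1 h1
    · intro hua
      rw [hua, inv_zero_pt hΦi hΦ0, sqz_zero hA, hΦ0]

/-- **`Z` takes values in `D ∪ {a, b}`.** [folklore] -/
theorem sqd_Z_mem (hZ : ∀ u, Z u = @ite ℂ (R u = b) (Classical.propDecidable _) b (Φ (A (ψ (R u)))))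
    (hψ : ψ = invFunOn Φ {z : ℂ | 0 ≤ z.im}) (hΦi : InjOn Φ {z : ℂ | 0 ≤ z.im})
    (hsurj : closure D \ {b} ⊆ Φ '' {z : ℂ | 0 ≤ z.im}) (hΦ0 : Φ 0 = a)
    (hΦD : ∀ z : ℂ, 0 < z.im → Φ z ∈ D)
    (hRcl : ∀ u, R u ∈ closure D) (he0 : 0 < e) (he1 : e ≤ 1 / 2)
    (hA : ∀ z, A z = (‖z‖ : ℂ) * Complex.exp (Complex.I * ((e : ℂ) +
      (1 - 2 * (e : ℂ) / (Real.pi : ℂ)) * (Complex.arg z : ℂ)))) (u : ℝ) :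
    Z u = a ∨ Z u = b ∨ Z u ∈ D := by
  by_cases hb : R u = b
  · exact Or.inr (Or.inl (sqd_Z_of_eq hZ hb))
  by_cases ha : R u = a
  · exact Or.inl ((sqd_Z_eq_a_iff hZ hψ hΦi hsurj hΦ0 hRcl he0 he1 hA u).2 ha)
  right; right
  rw [sqd_Z_of_ne hZ hb]
  obtain ⟨him, -⟩ := sqd_psi_R hψ hsurj hRcl hb
  have hne : ψ (R u) ≠ 0 := by
    subst hψ
    exact fun h0 => ha ((inv_eq_zero_iff hΦi hsurj hΦ0 ⟨hRcl u, hb⟩).1 h0)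
  exact hΦD _ (sqz_im_pos he0 he1 hA him hne)

/-- **`Z` separates what `R` separates**: `Z s = Z t → R s = R t`. [folklore] -/
theorem sqd_R_eq_of_Z_eq (hZ : ∀ u, Z u = @ite ℂ (R u = b) (Classical.propDecidable _) b (Φ (A (ψ (R u)))))
    (hψ : ψ = invFunOn Φ {z : ℂ | 0 ≤ z.im}) (hΦi : InjOn Φ {z : ℂ | 0 ≤ z.im})
    (hsurj : closure D \ {b} ⊆ Φ '' {z : ℂ | 0 ≤ z.im}) (hRcl : ∀ u, R u ∈ closure D)
    (he0 : 0 < e) (he1 : e ≤ 1 / 2)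
    (hA : ∀ z, A z = (‖z‖ : ℂ) * Complex.exp (Complex.I * ((e : ℂ) +
      (1 - 2 * (e : ℂ) / (Real.pi : ℂ)) * (Complex.arg z : ℂ))))
    (hΦb : ∀ z : ℂ, 0 ≤ z.im → Φ z ≠ b) {s t : ℝ} (hst : Z s = Z t) : R s = R t := by
  have hiff := sqd_Z_eq_b_iff hZ hψ hsurj hRcl he0 he1 hA hΦb
  by_cases hs : R s = b
  · have ht : R t = b := (hiff t).1 (hst ▸ (hiff s).2 hs)
    rw [hs, ht]
  · have ht : R t ≠ b := fun ht => hs ((hiff s).1 (hst.symm ▸ (hiff t).2 ht))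
    rw [sqd_Z_of_ne hZ hs, sqd_Z_of_ne hZ ht] at hst
    obtain ⟨hims, -⟩ := sqd_psi_R hψ hsurj hRcl hs
    obtain ⟨himt, -⟩ := sqd_psi_R hψ hsurj hRcl ht
    have h1 := hΦi (sqz_im_nonneg he0 he1 hA hims) (sqz_im_nonneg he0 he1 hA himt) hst
    have h2 := sqz_injOn he0 he1 hA hims himt h1
    subst hψ
    exact inv_injOn hsurj ⟨hRcl s, hs⟩ ⟨hRcl t, ht⟩ h2

/-- **Injectivity of `Z` up to the tail.** [folklore] -/
theorem sqd_Z_inj (hR : ∀ u, R u = P (projIcc 0 1 zero_le_one u))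
    (hZ : ∀ u, Z u = @ite ℂ (R u = b) (Classical.propDecidable _) b (Φ (A (ψ (R u)))))
    (hψ : ψ = invFunOn Φ {z : ℂ | 0 ≤ z.im}) (hΦi : InjOn Φ {z : ℂ | 0 ≤ z.im})
    (hsurj : closure D \ {b} ⊆ Φ '' {z : ℂ | 0 ≤ z.im}) (hRcl : ∀ u, R u ∈ closure D)
    (he0 : 0 < e) (he1 : e ≤ 1 / 2)
    (hA : ∀ z, A z = (‖z‖ : ℂ) * Complex.exp (Complex.I * ((e : ℂ) +
      (1 - 2 * (e : ℂ) / (Real.pi : ℂ)) * (Complex.arg z : ℂ))))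
    (hΦb : ∀ z : ℂ, 0 ≤ z.im → Φ z ≠ b)
    (hPinj : ∀ s t : I, s < t → P s = P t → τ ≤ (s : ℝ)) {s t : ℝ} (hs : s ∈ Icc (0 : ℝ) 1)
    (ht : t ∈ Icc (0 : ℝ) 1) (hlt : s < t) (hst : Z s = Z t) : τ ≤ s :=
  trim_R_inj hR hPinj hs ht hlt (sqd_R_eq_of_Z_eq hZ hψ hΦi hsurj hRcl he0 he1 hA hΦb hst)

/-- **The constant tail of `Z`**: `Z u = Z 1` for `u ≥ τ`. [folklore] -/
theorem sqd_Z_tail (hR : ∀ u, R u = P (projIcc 0 1 zero_le_one u))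
    (hZ : ∀ u, Z u = @ite ℂ (R u = b) (Classical.propDecidable _) b (Φ (A (ψ (R u)))))
    (hτ0 : 0 ≤ τ) (hPtail : ∀ t : I, τ ≤ (t : ℝ) → P t = P 1) {u : ℝ} (hu : τ ≤ u) :
    Z u = Z 1 := by
  rw [hZ u, hZ 1, trim_R_tail hR hτ0 hPtail hu, (trim_R_zero_one hR).2]

/-! ### Continuity of `Z` -/

/-- `Z` is continuous at every point which is not a visit of `b`. [folklore] -/
theorem sqd_Z_continuousAt (hR : ∀ u, R u = P (projIcc 0 1 zero_le_one u))
    (hZ : ∀ u, Z u = @ite ℂ (R u = b) (Classical.propDecidable _) b (Φ (A (ψ (R u)))))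
    (hψ : ψ = invFunOn Φ {z : ℂ | 0 ≤ z.im}) (hΦc : ContinuousOn Φ {z : ℂ | 0 ≤ z.im})
    (hsurj : closure D \ {b} ⊆ Φ '' {z : ℂ | 0 ≤ z.im})
    (hψc : ContinuousOn ψ (closure D \ {b})) (hRcl : ∀ u, R u ∈ closure D)
    (he0 : 0 < e) (he1 : e ≤ 1 / 2)
    (hA : ∀ z, A z = (‖z‖ : ℂ) * Complex.exp (Complex.I * ((e : ℂ) +
      (1 - 2 * (e : ℂ) / (Real.pi : ℂ)) * (Complex.arg z : ℂ)))) {u : ℝ} (h : R u ≠ b) :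
    ContinuousAt Z u := by
  have hRc := (trim_R_continuous hR).continuousAt (x := u)
  have hev : ∀ᶠ v in 𝓝 u, R v ≠ b := hRc.eventually_ne h
  have h1 : Tendsto R (𝓝 u) (𝓝[closure D \ {b}] (R u)) :=
    tendsto_nhdsWithin_iff.2 ⟨hRc, hev.mono fun v hv => ⟨hRcl v, hv⟩⟩
  have hmaps : MapsTo ψ (closure D \ {b}) {z : ℂ | 0 ≤ z.im} := fun p hp => by
    subst hψ; exact (inv_spec hsurj hp).1
  have h2 : Tendsto ψ (𝓝[closure D \ {b}] (R u)) (𝓝[{z : ℂ | 0 ≤ z.im}] (ψ (R u))) :=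
    (hψc _ ⟨hRcl u, h⟩).tendsto_nhdsWithin hmaps
  have him : 0 ≤ (ψ (R u)).im := hmaps ⟨hRcl u, h⟩
  have h3 : Tendsto A (𝓝[{z : ℂ | 0 ≤ z.im}] (ψ (R u))) (𝓝[{z : ℂ | 0 ≤ z.im}] (A (ψ (R u)))) :=
    (sqz_continuousOn hA _ him).tendsto_nhdsWithin fun z hz => sqz_im_nonneg he0 he1 hA hz
  have h4 : Tendsto Φ (𝓝[{z : ℂ | 0 ≤ z.im}] (A (ψ (R u)))) (𝓝 (Φ (A (ψ (R u))))) :=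
    hΦc _ (sqz_im_nonneg he0 he1 hA him)
  have h5 := h4.comp (h3.comp (h2.comp h1))
  rw [ContinuousAt, sqd_Z_of_ne hZ h]
  refine h5.congr' ?_
  exact hev.mono fun v hv => (sqd_Z_of_ne hZ hv).symm

/-- **At the first visit `j` of `b`, `Z → b` from the left** (`ψ → ∞`, `A → ∞`, `Φ → b`).
[folklore] -/
theorem sqd_Z_tendsto_left (hR : ∀ u, R u = P (projIcc 0 1 zero_le_one u))
    (hZ : ∀ u, Z u = @ite ℂ (R u = b) (Classical.propDecidable _) b (Φ (A (ψ (R u)))))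
    (hj : j = sInf ({(1 : ℝ)} ∪ {u | u ∈ Icc (0 : ℝ) 1 ∧ R u = b}))
    (hψ : ψ = invFunOn Φ {z : ℂ | 0 ≤ z.im}) (hΦc : ContinuousOn Φ {z : ℂ | 0 ≤ z.im})
    (hΦb : ∀ z : ℂ, 0 ≤ z.im → Φ z ≠ b)
    (hΦinf : Tendsto Φ (cocompact ℂ ⊓ 𝓟 {z : ℂ | 0 ≤ z.im}) (𝓝 b))
    (hsurj : closure D \ {b} ⊆ Φ '' {z : ℂ | 0 ≤ z.im}) (hRcl : ∀ u, R u ∈ closure D)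
    (hbD : b ∉ D) (hP0 : P 0 ∈ D) (he0 : 0 < e) (he1 : e ≤ 1 / 2)
    (hA : ∀ z, A z = (‖z‖ : ℂ) * Complex.exp (Complex.I * ((e : ℂ) +
      (1 - 2 * (e : ℂ) / (Real.pi : ℂ)) * (Complex.arg z : ℂ)))) (hRj : R j = b) :
    Tendsto Z (𝓝[<] j) (𝓝 b) := by
  have hj0 : 0 < j := trim_j_pos hR hj hbD hP0
  have hj1 : j ≤ 1 := (trim_j_spec hR hj).1.2
  have hev : ∀ᶠ v in 𝓝[<] j, v ∈ Ioo 0 j := Ioo_mem_nhdsLT hj0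
  have hne : ∀ v ∈ Ioo 0 j, R v ≠ b := fun v hv =>
    trim_R_ne_b_of_lt hj hv.2 ⟨hv.1.le, hv.2.le.trans hj1⟩
  have h1 : Tendsto R (𝓝[<] j) (𝓝[closure D \ {b}] b) := by
    refine tendsto_nhdsWithin_iff.2 ⟨?_, hev.mono fun v hv => ⟨hRcl v, hne v hv⟩⟩
    have h := (trim_R_continuous hR).continuousAt (x := j)
    rw [ContinuousAt, hRj] at h
    exact h.mono_left nhdsWithin_le_nhds
  have h2 : Tendsto ψ (𝓝[closure D \ {b}] b) (cocompact ℂ ⊓ 𝓟 {z : ℂ | 0 ≤ z.im}) := by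
    subst hψ
    exact tendsto_inf.2 ⟨inv_tendsto_cocompact hΦc hΦb hsurj,
      tendsto_principal.2 (eventually_mem_nhdsWithin.mono fun p hp => (inv_spec hsurj hp).1)⟩
  have h4 := hΦinf.comp ((sqz_tendsto_cocompact he0 he1 hA).comp (h2.comp h1))
  refine h4.congr' ?_
  exact hev.mono fun v hv => (sqd_Z_of_ne hZ (hne v hv)).symm

/-- **`Z` is continuous on `[i, j]`.** [folklore] -/
theorem sqd_Z_continuousOn (hR : ∀ u, R u = P (projIcc 0 1 zero_le_one u))
    (hZ : ∀ u, Z u = @ite ℂ (R u = b) (Classical.propDecidable _) b (Φ (A (ψ (R u)))))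
    (hi : i = sSup ({(0 : ℝ)} ∪ {u | u ∈ Icc (0 : ℝ) 1 ∧ R u = a}))
    (hj : j = sInf ({(1 : ℝ)} ∪ {u | u ∈ Icc (0 : ℝ) 1 ∧ R u = b}))
    (hψ : ψ = invFunOn Φ {z : ℂ | 0 ≤ z.im}) (hΦc : ContinuousOn Φ {z : ℂ | 0 ≤ z.im})
    (hΦb : ∀ z : ℂ, 0 ≤ z.im → Φ z ≠ b)
    (hΦinf : Tendsto Φ (cocompact ℂ ⊓ 𝓟 {z : ℂ | 0 ≤ z.im}) (𝓝 b))
    (hsurj : closure D \ {b} ⊆ Φ '' {z : ℂ | 0 ≤ z.im})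
    (hψc : ContinuousOn ψ (closure D \ {b})) (hRcl : ∀ u, R u ∈ closure D)
    (hbD : b ∉ D) (hP0 : P 0 ∈ D) (he0 : 0 < e) (he1 : e ≤ 1 / 2)
    (hA : ∀ z, A z = (‖z‖ : ℂ) * Complex.exp (Complex.I * ((e : ℂ) +
      (1 - 2 * (e : ℂ) / (Real.pi : ℂ)) * (Complex.arg z : ℂ)))) :
    ContinuousOn Z (Icc i j) := by
  intro u hu
  by_cases h : R u = b
  · have huj : u = j := trim_eq_j_of_R_eq_b hR hi hj hu h
    have hRj : R j = b := huj ▸ h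
    have hcw : ContinuousWithinAt Z (Iic j) j := by
      rw [← continuousWithinAt_Iio_iff_Iic, ContinuousWithinAt, sqd_Z_of_eq hZ hRj]
      exact sqd_Z_tendsto_left hR hZ hj hψ hΦc hΦb hΦinf hsurj hRcl hbD hP0 he0 he1 hA hRj
    rw [huj]
    exact hcw.mono Icc_subset_Iic_self
  · exact (sqd_Z_continuousAt hR hZ hψ hΦc hsurj hψc hRcl he0 he1 hA h).continuousWithinAt

/-- **`Z` is injective on `[i, min j τ]`.** [folklore] -/
theorem sqd_Z_injOn (hR : ∀ u, R u = P (projIcc 0 1 zero_le_one u))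
    (hZ : ∀ u, Z u = @ite ℂ (R u = b) (Classical.propDecidable _) b (Φ (A (ψ (R u)))))
    (hi : i = sSup ({(0 : ℝ)} ∪ {u | u ∈ Icc (0 : ℝ) 1 ∧ R u = a}))
    (hj : j = sInf ({(1 : ℝ)} ∪ {u | u ∈ Icc (0 : ℝ) 1 ∧ R u = b}))
    (hψ : ψ = invFunOn Φ {z : ℂ | 0 ≤ z.im}) (hΦi : InjOn Φ {z : ℂ | 0 ≤ z.im})
    (hsurj : closure D \ {b} ⊆ Φ '' {z : ℂ | 0 ≤ z.im}) (hRcl : ∀ u, R u ∈ closure D)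
    (he0 : 0 < e) (he1 : e ≤ 1 / 2)
    (hA : ∀ z, A z = (‖z‖ : ℂ) * Complex.exp (Complex.I * ((e : ℂ) +
      (1 - 2 * (e : ℂ) / (Real.pi : ℂ)) * (Complex.arg z : ℂ))))
    (hΦb : ∀ z : ℂ, 0 ≤ z.im → Φ z ≠ b)
    (hPinj : ∀ s t : I, s < t → P s = P t → τ ≤ (s : ℝ)) :
    InjOn Z (Icc i (min j τ)) := by
  have hsub : Icc i (min j τ) ⊆ Icc (0 : ℝ) 1 := fun u hu =>
    trim_Icc_subset hR hi hj ⟨hu.1, hu.2.trans (min_le_left _ _)⟩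
  intro s hs t ht hst
  by_contra hne
  rcases lt_or_gt_of_ne hne with hlt | hlt
  · have h := sqd_Z_inj hR hZ hψ hΦi hsurj hRcl he0 he1 hA hΦb hPinj (hsub hs) (hsub ht) hlt hst
    have h' : t ≤ τ := ht.2.trans (min_le_right _ _)
    linarith
  · have h := sqd_Z_inj hR hZ hψ hΦi hsurj hRcl he0 he1 hA hΦb hPinj (hsub ht) (hsub hs) hlt
      hst.symm
    have h' : s ≤ τ := hs.2.trans (min_le_right _ _)
    linarith

/-! ### The trace `M = Z([i, j])` -/

/-- **`M = Z([i, j]) = Z([i, min j τ])`** (the tail adds nothing). [folklore] -/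
theorem sqd_M_eq (hR : ∀ u, R u = P (projIcc 0 1 zero_le_one u))
    (hZ : ∀ u, Z u = @ite ℂ (R u = b) (Classical.propDecidable _) b (Φ (A (ψ (R u)))))
    (hτ0 : 0 ≤ τ) (hPtail : ∀ t : I, τ ≤ (t : ℝ) → P t = P 1) (hiτ : i ≤ τ) :
    Z '' Icc i j = Z '' Icc i (min j τ) := by
  apply Subset.antisymm
  · rintro _ ⟨u, hu, rfl⟩
    rcases le_or_gt u τ with hut | hut
    · exact ⟨u, ⟨hu.1, le_min hu.2 hut⟩, rfl⟩
    · refine ⟨τ, ⟨hiτ, le_min (hut.le.trans hu.2) le_rfl⟩, ?_⟩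
      rw [sqd_Z_tail hR hZ hτ0 hPtail le_rfl, sqd_Z_tail hR hZ hτ0 hPtail hut.le]
  · exact image_mono (Icc_subset_Icc_right (min_le_left _ _))

/-- `b ∉ M` unless the polyline visits `b`. [folklore] -/
theorem sqd_b_not_mem_M (hR : ∀ u, R u = P (projIcc 0 1 zero_le_one u))
    (hZ : ∀ u, Z u = @ite ℂ (R u = b) (Classical.propDecidable _) b (Φ (A (ψ (R u)))))
    (hi : i = sSup ({(0 : ℝ)} ∪ {u | u ∈ Icc (0 : ℝ) 1 ∧ R u = a}))
    (hj : j = sInf ({(1 : ℝ)} ∪ {u | u ∈ Icc (0 : ℝ) 1 ∧ R u = b}))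
    (hψ : ψ = invFunOn Φ {z : ℂ | 0 ≤ z.im})
    (hsurj : closure D \ {b} ⊆ Φ '' {z : ℂ | 0 ≤ z.im}) (hRcl : ∀ u, R u ∈ closure D)
    (he0 : 0 < e) (he1 : e ≤ 1 / 2)
    (hA : ∀ z, A z = (‖z‖ : ℂ) * Complex.exp (Complex.I * ((e : ℂ) +
      (1 - 2 * (e : ℂ) / (Real.pi : ℂ)) * (Complex.arg z : ℂ))))
    (hΦb : ∀ z : ℂ, 0 ≤ z.im → Φ z ≠ b) (hRj : R j ≠ b) : b ∉ Z '' Icc i j := by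
  rintro ⟨u, hu, hub⟩
  have hRu : R u = b := (sqd_Z_eq_b_iff hZ hψ hsurj hRcl he0 he1 hA hΦb u).1 hub
  exact hRj (trim_eq_j_of_R_eq_b hR hi hj hu hRu ▸ hRu)

/-- `a ∈ M ↔ R i = a` (for `i ≤ j`). [folklore] -/
theorem sqd_a_mem_M_iff (hR : ∀ u, R u = P (projIcc 0 1 zero_le_one u))
    (hZ : ∀ u, Z u = @ite ℂ (R u = b) (Classical.propDecidable _) b (Φ (A (ψ (R u)))))
    (hi : i = sSup ({(0 : ℝ)} ∪ {u | u ∈ Icc (0 : ℝ) 1 ∧ R u = a}))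
    (hj : j = sInf ({(1 : ℝ)} ∪ {u | u ∈ Icc (0 : ℝ) 1 ∧ R u = b}))
    (hψ : ψ = invFunOn Φ {z : ℂ | 0 ≤ z.im}) (hΦi : InjOn Φ {z : ℂ | 0 ≤ z.im})
    (hsurj : closure D \ {b} ⊆ Φ '' {z : ℂ | 0 ≤ z.im}) (hΦ0 : Φ 0 = a)
    (hRcl : ∀ u, R u ∈ closure D) (he0 : 0 < e) (he1 : e ≤ 1 / 2)
    (hA : ∀ z, A z = (‖z‖ : ℂ) * Complex.exp (Complex.I * ((e : ℂ) +
      (1 - 2 * (e : ℂ) / (Real.pi : ℂ)) * (Complex.arg z : ℂ)))) (hij : i ≤ j) :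
    a ∈ Z '' Icc i j ↔ R i = a := by
  have hiff := sqd_Z_eq_a_iff hZ hψ hΦi hsurj hΦ0 hRcl he0 he1 hA
  constructor
  · rintro ⟨u, hu, hua⟩
    have hRu : R u = a := (hiff u).1 hua
    rwa [trim_eq_i_of_R_eq_a hR hi hj hu hRu] at hRu
  · intro h
    exact ⟨i, ⟨le_rfl, hij⟩, (hiff i).2 h⟩

end Summit.CriticalPhenomena.SAWScalingLimit.Theorems
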